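import Summits.ResolutionOfSingularities.ResolutionOfSingularities.Theorems.OddCrossCutKernels2
import HarnessLib

/-!
# OddCrossCutClasses — decomp-res node «OddCrossCut» (lens-2 g23)

Content VERBATIM from the decomp-res lens-2 g23 node `HOME/decomp-res-lens-2/g23/OddCrossCut.lean` (pin aae59dc8, 6
388 l; HOME = run/shared/lean/pub/decomp-res); CRITIC-LEDGER row 184 CLEARED ((X***) `OddCrossExit`
DECIDED-MOD-PORT(M+) +1 · MAP 0: residue-characteristic ≠ 2 deep crosses typed as a CLASS WITH TAILS + the odd
guard; exit package decided on paper to cn27 standard by ODD DOMINATION; exact re-location of `IsDeepSpecialPt`);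
landing orders NEXT-g24 §Landing + critic rider INBOX :970: ONLY the NEW part §Z (node lines 5511–6388) is landed —
the node's CARRIED copies of g14–g22 (lines 306–4942, 4991–5507; ns `…Theses.OddCrossCut`) are NOT landed
(DELETE-on-landing: they ARE the tree modules
PinchCut/JetCut/PurityCut/SplitCut/CylinderCut/SpreadCut/CrossCut/DeepCrossCut*, opened here instead); namespace
`…Theses.OddCrossCut` ↦ `…Theorems.OddCrossCut`; all files `--kind proof --supports
stmt-ResolutionOfSingularities-29273` (the ring-kernel file as helper).  Farm (node, critic re-farm): rc 0 · 0 err ·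
0 warn · 0 sorry · axioms std.

§Z.2–§Z.3 (NEW, point / curve level) — the UNGUARDED deep-cross datum `IsDeepCrossDatum` with
`isUniformDeepCross_iff_datum` (against the TREE's guarded `DeepCrossCut.IsUniformDeepCross`), the ODD class (d‴)
`IsUniformOddCross` = datum + ODD GUARD (`isUniformOddCross_iff_datum`, the guard kernels,
`not_isUniformDeepCross_of_isUniformOddCross`, `isDeepCrossDatum_of_isUniformOddCross`,
`ringChar_residueField_eq_three_of_three_eq_zero`, `oddGuard_of_three_eq_zero`), the ENGINE `OddCrossExit` (untagged
`def … : Prop`, hypothesis BY NAME — DECIDED on paper by odd domination §Z.1; kernel port = (X**)'s) with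
`OddCrossExit57` / `oddCrossExit57_of_oddCrossExit`, the point class `IsOddCrossPt` + lemmas,
`isTopComponent_of_isUniformOddCross`, `isComponentExitPt_of_isOddCrossPt`.

(Sources: Hironaka1964 Ch. III; CossartJannsenSaito2020 Ch. 2, Ch. 8–9; CossartPiltant2008 Prop. 4.2;
CossartPiltant2019 Rem. 3.2; BierstoneGrigorievMilmanWlodarczyk2011 §3.1; Moh1987; Hauser2010Kangaroo; Giraud1975;
Narasimhan1983.)
-/

open CategoryTheory AlgebraicGeometry TopologicalSpace IsLocalRing
open Literature.AlgebraicGeometry.Resolution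
open Summit.ResolutionOfSingularities.ResolutionOfSingularities.Theorems
open Summit.ResolutionOfSingularities.ResolutionOfSingularities.Theorems.WeakOrderReduction
open Summit.ResolutionOfSingularities.ResolutionOfSingularities.Theorems.DeltaFaceCutClasses
open Summit.ResolutionOfSingularities.ResolutionOfSingularities.Theorems.RelativeDeltaCut
open Summit.ResolutionOfSingularities.ResolutionOfSingularities.Theorems.CurveLeafExit
open Summit.ResolutionOfSingularities.ResolutionOfSingularities.Theorems.DeepCrossCut
open Summit.ResolutionOfSingularities.ResolutionOfSingularities.Theorems.PinchCut
open Summit.ResolutionOfSingularities.ResolutionOfSingularities.Theorems.JetCut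
open Summit.ResolutionOfSingularities.ResolutionOfSingularities.Theorems.PurityCut
open Summit.ResolutionOfSingularities.ResolutionOfSingularities.Theorems.SplitCut
open Summit.ResolutionOfSingularities.ResolutionOfSingularities.Theorems.CylinderCut
open Summit.ResolutionOfSingularities.ResolutionOfSingularities.Theorems.SpreadCut
open Summit.ResolutionOfSingularities.ResolutionOfSingularities.Theorems.CrossCut
open Summit.ResolutionOfSingularities.ResolutionOfSingularities.Theorems.DeepCrossCut
open MvPolynomial

namespace Summit.ResolutionOfSingularities.ResolutionOfSingularities.Theorems.OddCrossCut

/-! ### §Z.2  point / curve level — the UNGUARDED deep-cross datum, the ODD class (d‴) `IsUniformOddCross`, ENGINE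
(X***) `OddCrossExit`,
the decided class `IsOddCrossPt`, guard kernels -/

/-- **THE UNGUARDED DEEP-CROSS DATUM** [g23] (`IsDeepCrossDatum I n q d η₁ η₂`): the rev ≤ 7 TWELVE-CLAUSE
conjunction of g21's uniform deep
cross (marking `2`, `q ≥ 1`, `m = 2q+1 ≤ d`, `d` odd, two distinct curve points meeting, `T` in the order-`n` locus
and open in it, the three
letters at the closed points by position) — WITHOUT any residue-characteristic clause.  rev8's `IsUniformDeepCross`
IS `datum ∧ (char κ = 2
along T)` (`isUniformDeepCross_iff_datum`), the NEW odd class IS `datum ∧ (char κ ∤ 2·gcd(m,d) along T)`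
(`isUniformOddCross_iff_datum`): the
two guards are DISJOINT and the odd class is exactly «the complement the guard pushed into the residual» MINUS the
doubly divisible residue
characteristics `p ∣ m, p ∣ d` (§Z.1 GUARD).  DEFINITION (support: the common trunk of the two classes). -/
def IsDeepCrossDatum {Y : Scheme.{0}} (I : Y.IdealSheafData) (n q d : ℕ) (η₁ η₂ : Y) : Prop :=
  n = 2 ∧ 1 ≤ q ∧ 2 * q + 1 ≤ d ∧ Odd d ∧ η₁ ≠ η₂ ∧ IsCurvePt η₁ ∧ IsCurvePt η₂ ∧ (∃ x : Y, η₁ ⤳ x ∧ η₂ ⤳ x) ∧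
    (∀ x : Y, (η₁ ⤳ x ∨ η₂ ⤳ x) → idealOrder I x = ((n : ℕ) : ℕ∞)) ∧
    (∃ U : Y.Opens, (∀ x : Y, (η₁ ⤳ x ∨ η₂ ⤳ x) → x ∈ U) ∧
      ∀ x : Y, x ∈ U → idealOrder I x = ((n : ℕ) : ℕ∞) → (η₁ ⤳ x ∨ η₂ ⤳ x)) ∧
    ∀ y : Y, IsClosed ({y} : Set Y) →
      (η₁ ⤳ y → η₂ ⤳ y → IsDeepCrossAt I q d η₁ η₂ y) ∧
      (η₁ ⤳ y → ¬ η₂ ⤳ y → IsSteepPairAt I (2 * q + 1) d η₁ y) ∧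
      (η₂ ⤳ y → ¬ η₁ ⤳ y → IsFlankAt I q η₂ y)

/-- rev8's guarded class IS the datum plus the residue-characteristic-`2` guard (the clause order differs;
hypothesis-free `Iff`).  KERNEL
(PROVED; letter bookkeeping). [folklore] -/
theorem isUniformDeepCross_iff_datum {Y : Scheme.{0}} (I : Y.IdealSheafData) (n q d : ℕ) (η₁ η₂ : Y) :
    IsUniformDeepCross I n q d η₁ η₂ ↔
      IsDeepCrossDatum I n q d η₁ η₂ ∧ ∀ x : Y, (η₁ ⤳ x ∨ η₂ ⤳ x) → ringChar (ResidueField (Y.presheaf.stalk x)) = 2 := by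
  constructor
  · rintro ⟨hn, hq, hd, ho, hne, hc₁, hc₂, hm, hT, hχ, hU, hL⟩
    exact ⟨⟨hn, hq, hd, ho, hne, hc₁, hc₂, hm, hT, hU, hL⟩, hχ⟩
  · rintro ⟨⟨hn, hq, hd, ho, hne, hc₁, hc₂, hm, hT, hU, hL⟩, hχ⟩
    exact ⟨hn, hq, hd, ho, hne, hc₁, hc₂, hm, hT, hχ, hU, hL⟩

/-- **UNIFORM ODD CROSS** [g23] (`IsUniformOddCross I n q d η₁ η₂`) — THE UNIT OF ENGINE (X***), window (d‴): the
unguarded deep-cross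
datum (twelve clauses, all flat depths `d ≥ m` at once, members in the Newton member ideal, steep-pair and flank
letters along the branches)
TOGETHER WITH THE ODD GUARD ALONG `T`: `∀ x, (η₁ ⤳ x ∨ η₂ ⤳ x) → ¬ ringChar κ(x) ∣ 2·gcd(2q+1, d)` — for a field
`κ(x)` (characteristic `0`
or prime) this says EXACTLY: residue characteristic `≠ 2` AND not a common divisor of `m = 2q+1` and `d`
(`ringChar_ne_two_of_isUniformOddCross`,
`not_ringChar_dvd_gcd_of_isUniformOddCross`; characteristic `0` passes).  WHY BOTH HALVES (§Z.1): `≠ 2` — in residue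
characteristic `2` the
class is (X**) (rev8), decided by the parity calculus; `∤ gcd(m,d)` — on the exceptional divisors dominating the
steep branch the units of the
letter vary along `C₁`, and when `p ∣ m`, `p ∣ d` a member with `t·∂_t log(ε₁/ε₂) ≡ 2` at a steep-pair point carries
an isolated `τ = 1` point
of E**-type on the secondary curve `Γ_v` that the package does not resolve (§Z.1 GUARD; LESSON 6: the decision
covers every residue
characteristic the class types).  INHABITED: the `𝔽₃` datum of critic row 175 (`oddX3`, `(q,d) = (2,7)`, `3 ∤ 2`),
and every bed member
`z² + u₁^m + v²u₂^d` (odd `3 ≤ m ≤ d`) over a field of characteristic `p ∤ 2·gcd(m,d)` together with a flank witness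
(`(f, v²u₂^{d+1})`).
DISJOINT from rev8's `IsUniformDeepCross` (`not_isUniformDeepCross_of_isUniformOddCross`).  DEFINITION (NEW class predicate). -/
def IsUniformOddCross {Y : Scheme.{0}} (I : Y.IdealSheafData) (n q d : ℕ) (η₁ η₂ : Y) : Prop :=
  n = 2 ∧ 1 ≤ q ∧ 2 * q + 1 ≤ d ∧ Odd d ∧ η₁ ≠ η₂ ∧ IsCurvePt η₁ ∧ IsCurvePt η₂ ∧ (∃ x : Y, η₁ ⤳ x ∧ η₂ ⤳ x) ∧
    (∀ x : Y, (η₁ ⤳ x ∨ η₂ ⤳ x) → idealOrder I x = ((n : ℕ) : ℕ∞)) ∧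
    (∀ x : Y, (η₁ ⤳ x ∨ η₂ ⤳ x) → ¬ (ringChar (ResidueField (Y.presheaf.stalk x)) ∣ 2 * Nat.gcd (2 * q + 1) d)) ∧
    (∃ U : Y.Opens, (∀ x : Y, (η₁ ⤳ x ∨ η₂ ⤳ x) → x ∈ U) ∧
      ∀ x : Y, x ∈ U → idealOrder I x = ((n : ℕ) : ℕ∞) → (η₁ ⤳ x ∨ η₂ ⤳ x)) ∧
    ∀ y : Y, IsClosed ({y} : Set Y) →
      (η₁ ⤳ y → η₂ ⤳ y → IsDeepCrossAt I q d η₁ η₂ y) ∧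
      (η₁ ⤳ y → ¬ η₂ ⤳ y → IsSteepPairAt I (2 * q + 1) d η₁ y) ∧
      (η₂ ⤳ y → ¬ η₁ ⤳ y → IsFlankAt I q η₂ y)

/-- The odd class IS the datum plus the odd guard (hypothesis-free `Iff`).  KERNEL (PROVED; letter bookkeeping). [folklore] -/
theorem isUniformOddCross_iff_datum {Y : Scheme.{0}} (I : Y.IdealSheafData) (n q d : ℕ) (η₁ η₂ : Y) :
    IsUniformOddCross I n q d η₁ η₂ ↔
      IsDeepCrossDatum I n q d η₁ η₂ ∧
        ∀ x : Y, (η₁ ⤳ x ∨ η₂ ⤳ x) → ¬ (ringChar (ResidueField (Y.presheaf.stalk x)) ∣ 2 * Nat.gcd (2 * q + 1) d) := by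
  constructor
  · rintro ⟨hn, hq, hd, ho, hne, hc₁, hc₂, hm, hT, hχ, hU, hL⟩
    exact ⟨⟨hn, hq, hd, ho, hne, hc₁, hc₂, hm, hT, hU, hL⟩, hχ⟩
  · rintro ⟨⟨hn, hq, hd, ho, hne, hc₁, hc₂, hm, hT, hU, hL⟩, hχ⟩
    exact ⟨hn, hq, hd, ho, hne, hc₁, hc₂, hm, hT, hχ, hU, hL⟩

/-- **THE ODD GUARD BY NAME** [g23; KERNEL (PROVED; letter bookkeeping)]. [folklore] -/
theorem not_ringChar_dvd_of_isUniformOddCross {Y : Scheme.{0}} {I : Y.IdealSheafData} {n q d : ℕ} {η₁ η₂ : Y}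
    (h : IsUniformOddCross I n q d η₁ η₂) {x : Y} (hx : η₁ ⤳ x ∨ η₂ ⤳ x) :
    ¬ (ringChar (ResidueField (Y.presheaf.stalk x)) ∣ 2 * Nat.gcd (2 * q + 1) d) := by
  obtain ⟨_, _, _, _, _, _, _, _, _, hχ, _⟩ := h
  exact hχ x hx

/-- Along `T` a uniform odd cross has residue characteristic `≠ 2` (first half of the guard).  KERNEL (PROVED). [folklore] -/
theorem ringChar_ne_two_of_isUniformOddCross {Y : Scheme.{0}} {I : Y.IdealSheafData} {n q d : ℕ} {η₁ η₂ : Y}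
    (h : IsUniformOddCross I n q d η₁ η₂) {x : Y} (hx : η₁ ⤳ x ∨ η₂ ⤳ x) :
    ringChar (ResidueField (Y.presheaf.stalk x)) ≠ 2 := by
  intro h2
  exact not_ringChar_dvd_of_isUniformOddCross h hx (by rw [h2]; exact dvd_mul_right 2 _)

/-- Along `T` the residue characteristic of a uniform odd cross divides NOT BOTH `m = 2q+1` and `d` (second half of
the guard).  KERNEL
(PROVED). [folklore] -/
theorem not_ringChar_dvd_gcd_of_isUniformOddCross {Y : Scheme.{0}} {I : Y.IdealSheafData} {n q d : ℕ} {η₁ η₂ : Y}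
    (h : IsUniformOddCross I n q d η₁ η₂) {x : Y} (hx : η₁ ⤳ x ∨ η₂ ⤳ x) :
    ¬ (ringChar (ResidueField (Y.presheaf.stalk x)) ∣ Nat.gcd (2 * q + 1) d) :=
  fun hg => not_ringChar_dvd_of_isUniformOddCross h hx (Dvd.dvd.mul_left hg 2)

/-- **THE TWO GUARDED CLASSES ARE DISJOINT** [g23; KERNEL (PROVED)]: the same datum cannot be a uniform deep cross
(residue characteristic
`2` along `T`) and a uniform odd cross (the branches meet, and at the meeting point the two guards contradict). [folklore] -/
theorem not_isUniformDeepCross_of_isUniformOddCross {Y : Scheme.{0}} {I : Y.IdealSheafData} {n q d : ℕ} {η₁ η₂ : Y}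
    (h : IsUniformOddCross I n q d η₁ η₂) : ¬ IsUniformDeepCross I n q d η₁ η₂ := by
  intro hD
  obtain ⟨_, _, _, _, _, _, _, ⟨x, hx₁, _⟩, _⟩ := id h
  exact ringChar_ne_two_of_isUniformOddCross h (Or.inl hx₁) (ringChar_eq_two_of_isUniformDeepCross hD (Or.inl hx₁))

/-- The odd class is a sub-datum (forget the guard).  KERNEL (PROVED). [folklore] -/
theorem isDeepCrossDatum_of_isUniformOddCross {Y : Scheme.{0}} {I : Y.IdealSheafData} {n q d : ℕ} {η₁ η₂ : Y}
    (h : IsUniformOddCross I n q d η₁ η₂) : IsDeepCrossDatum I n q d η₁ η₂ :=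
  ((isUniformOddCross_iff_datum I n q d η₁ η₂).mp h).1

/-- **THE ODD GUARD ON `𝔽₃`-DATA** [g23; KERNEL (PROVED)]: where `3 = 0` in the local ring (every point of an
`𝔽₃`-scheme — the datum
`oddX3`'s ambient `𝔸⁴_{𝔽₃}` and every blow-up of it), the residue field has characteristic `3`. [folklore] -/
theorem ringChar_residueField_eq_three_of_three_eq_zero {Y : Scheme.{0}} (x : Y) (h3 : (3 : Y.presheaf.stalk x) = 0) :
    ringChar (ResidueField (Y.presheaf.stalk x)) = 3 := by
  have h := congrArg (residue (Y.presheaf.stalk x)) h3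
  rw [map_ofNat, map_zero] at h
  exact CharP.ringChar_of_prime_eq_zero Nat.prime_three (by exact_mod_cast h)

/-- … so on `𝔽₃`-data the odd guard for `(q, d) = (2, 7)` holds at EVERY point (Probe control).  KERNEL (PROVED). [folklore] -/
theorem oddGuard_of_three_eq_zero {Y : Scheme.{0}} (x : Y) (h3 : (3 : Y.presheaf.stalk x) = 0) :
    ¬ (ringChar (ResidueField (Y.presheaf.stalk x)) ∣ 2 * Nat.gcd (2 * 2 + 1) 7) := by
  rw [ringChar_residueField_eq_three_of_three_eq_zero x h3]
  decide

/-- **ENGINE (X***) `OddCrossExit`** [g23; DECIDED (paper) · KERNEL PORT OPEN — proof device = ODD DOMINATION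
(module docstring §Z.1): the
COMBINATORIAL BED PACKAGE `𝒫(m,d)` of (X**) (the S3′ run of g21/g22 in the characteristic-`2` READING of LEMMA Y.C —
a finite datum of
`(m,d)` by the TERMINATION THEOREM (T4), kernel-checked in g22's `FanGame.lean`, and the PEEL LEMMA (T2)),
transported to `(Y, I)` centre by
centre (each centre the same named irreducible component of the intrinsic order-`2` locus `Top_j(T)`; permissible
because top-ness of a toric
stratum, `|a|, |b| ≥ 2`, is characteristic-free, and weakly admissible for every member by (T5) STEP 3 verbatim); at
its END the ODD exit
holds POINTWISE by the CROSS-TERM LEMMA (every order-`2` cone origin / top line surviving the characteristic-`2`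
stop carries a PAIR exponent,
hence an uncancellable `U_iU_j` in `in₂ = Q̄Z² + q(U)`, and `Q̄Z² + q`, `q ≠ 0`, is no multiple of a square when `2 ∈ κ×`:
`crossTerm_coeff`, `oddReading_line/point`, `tail_ne_pair`), by the JACOBIAN CRITERION on torus orbits for the
secondary curves `Γ_v`
(`dvd_two_of_dvd_deltaFun`; along the steep branch `dvd_of_dvd_deltaFunC` — THE place the guard `p ∤ gcd(m,d)` is
used), by EULER in the
`Z`-charts, and by the FLANK TOWER `(C₂; S₁; …; S_{q−1}) ⊂ 𝒫` over `C₂ ∖ C₁` (final exponent `m − 2q = 1`: order `≤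
1` over every point of
`C₂ ∖ C₁`, pinch points included).  NOT proved IN KERNEL: it stays a hypothesis of the kernels · `n = 2` · the odd
guard is a clause of the
class]: on a regular scheme, a uniform odd cross has an exit package with centres over `T = C₁ ∪ C₂`.  STATEMENT
(engine). (Sources: Hironaka1967; CossartJannsenSaito2020 Ch. 2, Ch. 8; CossartPiltant2008 Prop. 4.2;
CossartPiltant2019 Def. 3.5;
BierstoneGrigorievMilmanWlodarczyk2011 §3; StacksProject Tag 0805.) -/
def OddCrossExit : Prop :=
  ∀ (Y : Scheme.{0}), Scheme.IsRegular Y → ∀ (I : Y.IdealSheafData) (n q d : ℕ) (η₁ η₂ : Y),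
    IsUniformOddCross I n q d η₁ η₂ → PackageExitsOver I n {x : Y | η₁ ⤳ x ∨ η₂ ⤳ x}

/-- **THE CERTIFIED INSTANCE `OddCrossExit57`** [g23; the engine restricted to the inhabitant's letters `(q, d) =
(2, 7)`: the nine centres
of INSEP-vv7's package `(C₁; Σ₁; Λ; Λ′; Σ_Λ; Φ₃; C₂′; Σ′₁; Φ₆)` — chart identities `insepVV7_chart0…9`, valid over
EVERY commutative ring —
read in odd residue characteristic: §Z.1 RUN].  STATEMENT (engine instance). -/
def OddCrossExit57 : Prop :=
  ∀ (Y : Scheme.{0}), Scheme.IsRegular Y → ∀ (I : Y.IdealSheafData) (n : ℕ) (η₁ η₂ : Y),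
    IsUniformOddCross I n 2 7 η₁ η₂ → PackageExitsOver I n {x : Y | η₁ ⤳ x ∨ η₂ ⤳ x}

/-- The engine contains its certified instance by letter.  KERNEL (PROVED). [folklore] -/
theorem oddCrossExit57_of_oddCrossExit (h : OddCrossExit) : OddCrossExit57 :=
  fun Y hY I n η₁ η₂ hU => h Y hY I n 2 7 η₁ η₂ hU

/-- **ODD-CROSS point** [g23] (NEW CLASS, leaf (X***)): `y` lies on (or is a generic point of a branch of) a uniform
odd cross.  Inhabitants:
the tangle and every point of the two top curves of the `𝔽₃` datum `oddX3`.  DEFINITION (NEW class). -/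
def IsOddCrossPt {Y : Scheme.{0}} (I : Y.IdealSheafData) (n : ℕ) (y : Y) : Prop :=
  ∃ (q d : ℕ) (η₁ η₂ : Y), (η₁ ⤳ y ∨ η₂ ⤳ y) ∧ IsUniformOddCross I n q d η₁ η₂

/-- The odd-cross class lives at marking `2` only.  KERNEL (PROVED; letter bookkeeping). [folklore] -/
theorem eq_two_of_isOddCrossPt {Y : Scheme.{0}} {I : Y.IdealSheafData} {n : ℕ} {y : Y} (h : IsOddCrossPt I n y) : n = 2 := by
  obtain ⟨_, _, _, _, _, hn, _⟩ := h
  exact hn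

/-- An odd-cross point is a top point.  KERNEL (PROVED). [folklore] -/
theorem idealOrder_eq_of_isOddCrossPt {Y : Scheme.{0}} {I : Y.IdealSheafData} {n : ℕ} {y : Y} (h : IsOddCrossPt I n y) :
    idealOrder I y = ((n : ℕ) : ℕ∞) := by
  obtain ⟨_, _, _, _, hy, _, _, _, _, _, _, _, _, hT, _, _⟩ := h
  exact hT _ hy

/-- At an odd-cross point the residue characteristic is not `2`.  KERNEL (PROVED). [folklore] -/
theorem ringChar_ne_two_of_isOddCrossPt {Y : Scheme.{0}} {I : Y.IdealSheafData} {n : ℕ} {y : Y} (h : IsOddCrossPt I n y) :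
    ringChar (ResidueField (Y.presheaf.stalk y)) ≠ 2 := by
  obtain ⟨_, _, _, _, hy, hU⟩ := h
  exact ringChar_ne_two_of_isUniformOddCross hU hy

/-- **THE NEW CLASS IS DISJOINT FROM (X**)'s** [g23; KERNEL (PROVED)]: no point is both a deep-cross point (residue
characteristic `2`) and an
odd-cross point. [folklore] -/
theorem not_isDeepCrossPt_of_isOddCrossPt {Y : Scheme.{0}} {I : Y.IdealSheafData} {n : ℕ} {y : Y} (h : IsOddCrossPt I n y) :
    ¬ IsDeepCrossPt I n y := by
  rintro ⟨_, _, _, _, hy, hD⟩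
  exact ringChar_ne_two_of_isOddCrossPt h (ringChar_eq_two_of_isUniformDeepCross hD hy)

/-- **A UNIFORM ODD CROSS IS A TOP COMPONENT** [g23; KERNEL (PROVED)]. [folklore] -/
theorem isTopComponent_of_isUniformOddCross {Y : Scheme.{0}} {I : Y.IdealSheafData} {n q d : ℕ} {η₁ η₂ : Y}
    (h : IsUniformOddCross I n q d η₁ η₂) : IsTopComponent I n {x : Y | η₁ ⤳ x ∨ η₂ ⤳ x} := by
  obtain ⟨_, _, _, _, _, _, _, hmeet, hT, _, hU, _⟩ := h
  exact isTopComponent_of_branches hmeet hT hU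

/-- **ENGINE (X***) AT WORK, pointwise** [g23; KERNEL (PROVED)]: under `OddCrossExit`, every odd-cross point of a
regular scheme is a
component-exit point of g20's component port. [folklore] -/
theorem isComponentExitPt_of_isOddCrossPt {Y : Scheme.{0}} {I : Y.IdealSheafData} {n : ℕ} {y : Y}
    (hOX : OddCrossExit) (hY : Scheme.IsRegular Y) (h : IsOddCrossPt I n y) : IsComponentExitPt I n y := by
  obtain ⟨q, d, η₁, η₂, hy, hU⟩ := h
  exact ⟨{x : Y | η₁ ⤳ x ∨ η₂ ⤳ x}, hy, isTopComponent_of_isUniformOddCross hU, hOX Y hY I n q d η₁ η₂ hU⟩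

end Summit.ResolutionOfSingularities.ResolutionOfSingularities.Theorems.OddCrossCut
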